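import Summits.QuantumAdvantage.QuantumAdvantage.Theorems.CharDialWindowCounterB

/-! # CharDialWindowCounter — part 3/3 (mechanical split for landing of `CharDialWindowCounter`; content verbatim; scopes re-opened with their variables) -/

noncomputable section
open Finset

namespace Summit.QuantumAdvantage.AdviceFreeQNC0.WindowCounter
open Summit.QuantumAdvantage.AdviceFreeQNC0

section Main
variable (p : ℕ) [Fact p.Prime]

/-- the finite family of twists `μ = ψ_p(t)·ψ₃(r)`, `t ≠ 0`. -/
def twists : Finset (ZMod p × ZMod 3) := (univ.erase 0) ×ˢ univ

/-- the twist of a pair. -/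
def mu (x : ZMod p × ZMod 3) : ℂ := (ZMod.stdAddChar x.1 : ℂ) * ZMod.stdAddChar x.2

/-- CharDialWindowCounter helper `norm_mu` (decomp-qadv land package; see the module docstring). -/
theorem norm_mu (x : ZMod p × ZMod 3) : ‖mu p x‖ = 1 := by
  unfold mu; rw [norm_mul, AddChar.norm_apply, AddChar.norm_apply, mul_one]

/-- CharDialWindowCounter helper `twists_nonempty` (decomp-qadv land package; see the module docstring). -/
theorem twists_nonempty : (twists p).Nonempty := by
  refine ⟨(1, 0), ?_⟩
  simp only [twists, mem_product, mem_erase, mem_univ, and_true]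
  exact one_ne_zero

/-- CharDialWindowCounter helper `six_ne_zero` (decomp-qadv land package; see the module docstring). -/
theorem six_ne_zero (hp : 5 ≤ p) : ((6 : ℕ) : ZMod p) ≠ 0 := by
  intro h
  rw [ZMod.natCast_eq_zero_iff] at h
  have h2 : p ∣ 2 ∨ p ∣ 3 := (Nat.Prime.dvd_mul (Fact.out)).1 (by simpa using h)
  rcases h2 with h2 | h2
  · have := Nat.le_of_dvd (by norm_num) h2; omega
  · have := Nat.le_of_dvd (by norm_num) h2; omega

/-- CharDialWindowCounter helper `mu_pow_six_ne_one` (decomp-qadv land package; see the module docstring). -/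
theorem mu_pow_six_ne_one (hp : 5 ≤ p) {x : ZMod p × ZMod 3} (hx : x ∈ twists p) : mu p x ^ 6 ≠ 1 := by
  simp only [twists, mem_product, mem_erase, mem_univ, and_true] at hx
  unfold mu
  rw [mul_pow, ← char_natMul, ← char_natMul, show ((6 : ℕ) : ZMod 3) = 0 by decide, zero_mul,
    AddChar.map_zero_eq_one, mul_one]
  exact char_ne_one p (mul_ne_zero (six_ne_zero p hp) hx)

/-- the contraction constant `β(p) = max ‖1 ± μ³‖ < 2`. -/
def beta : ℝ := (twists p).sup' (twists_nonempty p) fun x => max ‖1 + mu p x ^ 3‖ ‖1 - mu p x ^ 3‖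

/-- CharDialWindowCounter helper `beta_lt_two` (decomp-qadv land package; see the module docstring). -/
theorem beta_lt_two (hp : 5 ≤ p) : beta p < 2 := by
  unfold beta
  rw [sup'_lt_iff]
  intro x hx
  have h6 := mu_pow_six_ne_one p hp hx
  have hn : ‖mu p x ^ 3‖ = 1 := by rw [norm_pow, norm_mu, one_pow]
  refine max_lt (norm_one_add_lt_two hn fun h => h6 ?_) ?_
  · rw [show (6 : ℕ) = 3 * 2 from rfl, pow_mul, h, one_pow]
  · rw [sub_eq_add_neg]
    refine norm_one_add_lt_two (by rw [norm_neg, hn]) fun h => h6 ?_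
    rw [show (6 : ℕ) = 3 * 2 from rfl, pow_mul, show mu p x ^ 3 = -1 by rw [← neg_neg (mu p x ^ 3), h]]
    norm_num

/-- CharDialWindowCounter helper `le_beta` (decomp-qadv land package; see the module docstring). -/
theorem le_beta {x : ZMod p × ZMod 3} (hx : x ∈ twists p) :
    ‖1 + mu p x ^ 3‖ ≤ beta p ∧ ‖1 - mu p x ^ 3‖ ≤ beta p := by
  have := le_sup' (fun x => max ‖1 + mu p x ^ 3‖ ‖1 - mu p x ^ 3‖) hx
  exact ⟨le_trans (le_max_left _ _) this, le_trans (le_max_right _ _) this⟩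

/-- CharDialWindowCounter helper `beta_nonneg` (decomp-qadv land package; see the module docstring). -/
theorem beta_nonneg : 0 ≤ beta p := by
  obtain ⟨x, hx⟩ := twists_nonempty p
  exact le_trans (norm_nonneg _) (le_beta p hx).1

/-- the contraction rate `κ = (6 + β)/8 < 1`. -/
def kappa : ℝ := (6 + beta p) / 8

/-- CharDialWindowCounter helper `kappa_nonneg` (decomp-qadv land package; see the module docstring). -/
theorem kappa_nonneg : 0 ≤ kappa p := by unfold kappa; have := beta_nonneg p; positivity

/-- CharDialWindowCounter helper `kappa_lt_one` (decomp-qadv land package; see the module docstring). -/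
theorem kappa_lt_one (hp : 5 ≤ p) : kappa p < 1 := by unfold kappa; have := beta_lt_two p hp; linarith

/-- the bound at window `ℓ`: `BW ℓ n = 2ⁿ κ^{⌊n/(2ℓ+3)⌋}`. -/
def BW (ℓ n : ℕ) : ℝ := 2 ^ n * kappa p ^ (n / (2 * ℓ + 3))

/-- CharDialWindowCounter helper `BW_nonneg` (decomp-qadv land package; see the module docstring). -/
theorem BW_nonneg (ℓ n : ℕ) : 0 ≤ BW p ℓ n := by unfold BW; have := kappa_nonneg p; positivity

variable {n : ℕ}

/-- every twisted window `GG` is `≤ BW`. -/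
theorem norm_GG_window_le {x : ZMod p × ZMod 3} (hx : x ∈ twists p) (ℓ : ℕ)
    (y : Fin (n + 1) → (Fin n → Bool) → Bool) (hy : WindowLocal ℓ y) (hℓn : ℓ ≤ n + 1) (c w : ℕ) :
    ‖GG (mu p x) (Etab ℓ y c w) (fun _ r P => ftab ℓ y c w r P) n 0 [] 0‖ ≤ BW p ℓ n := by
  unfold BW kappa
  exact norm_GG_le_kappa _ _ _ (norm_mu p x) (le_beta p hx).1 (le_beta p hx).2 (W := 2 * ℓ)
    (fun k ρ ρ' b P h => Etab_local ℓ y c w hy (by omega) k ρ ρ' b P h) (Etab_periodic ℓ y c w)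
    (fun k ρ ρ' P h => ftab_local ℓ y c w hy (by omega) hℓn ρ ρ' P h) (fun k r P => ftab_periodic ℓ y c w r P)
    (fun k r P => norm_ftab ℓ y c w r P) n 0 [] 0

/-- CharDialWindowCounter helper `norm_GG_plain_le` (decomp-qadv land package; see the module docstring). -/
theorem norm_GG_plain_le {x : ZMod p × ZMod 3} (hx : x ∈ twists p) (ℓ n : ℕ) :
    ‖GG (mu p x) (fun _ _ _ _ => false) (fun _ _ _ => 1) n 0 [] 0‖ ≤ BW p ℓ n := by
  unfold BW kappa
  exact norm_GG_le_kappa _ _ _ (norm_mu p x) (le_beta p hx).1 (le_beta p hx).2 (W := 2 * ℓ)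
    (fun _ _ _ _ _ _ => rfl) (fun _ _ _ _ => rfl) (fun _ _ _ _ _ => rfl) (fun _ _ _ => rfl)
    (fun _ _ _ => by simp) n 0 [] 0

/-- **mod-3 splitting**: `3 · Σ_{wt ≡ w} F(u) λ^{wt u} = Σ_r ψ₃(-r w) · GG(λ ψ₃(r))`. -/
theorem three_mul_classSum (ℓ : ℕ) (y : Fin (n + 1) → (Fin n → Bool) → Bool) (hy : WindowLocal ℓ y) (hℓ : 1 ≤ ℓ)
    (hℓn : ℓ ≤ n) (c : ℕ) (w : ℕ) (hw : w < 3) (t : ZMod p) :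
    (3 : ℂ) * ∑ u ∈ univ.filter (fun u : Fin n → Bool => wt u % 3 = w),
        (∏ g : Fin (n + 1), sgn (fires y c g u)) * (ZMod.stdAddChar t : ℂ) ^ wt u =
      ∑ r : ZMod 3, ZMod.stdAddChar (-(r * (w : ZMod 3))) *
        GG (mu p (t, r)) (Etab ℓ y c w) (fun _ r P => ftab ℓ y c w r P) n 0 [] 0 := by
  rw [sum_filter, mul_sum]
  have key : ∀ u : Fin n → Bool,
      (3 : ℂ) * (if wt u % 3 = w then (∏ g : Fin (n + 1), sgn (fires y c g u)) * (ZMod.stdAddChar t : ℂ) ^ wt u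
        else 0) =
      ∑ r : ZMod 3, ZMod.stdAddChar (-(r * (w : ZMod 3))) *
        ((mu p (t, r)) ^ wt u * pathSgn (Etab ℓ y c w) 0 [] 0 u * ftab ℓ y c w (regAt u n []) (0 + wt u)) := by
    intro u
    have hind : (3 : ℂ) * (if wt u % 3 = w then (1 : ℂ) else 0) =
        ∑ r : ZMod 3, ZMod.stdAddChar (-(r * (w : ZMod 3))) * (ZMod.stdAddChar r : ℂ) ^ wt u := by
      have h1 : (wt u % 3 = w) ↔ ((wt u : ZMod 3) - (w : ZMod 3) = 0) := by
        rw [sub_eq_zero, ZMod.natCast_eq_natCast_iff', Nat.mod_eq_of_lt hw]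
      have h2 := ite_eq_sum_char 3 ((wt u : ZMod 3) - (w : ZMod 3))
      simp only [Nat.cast_ofNat] at h2
      simp only [h1]
      rw [mul_ite, mul_one, mul_zero, h2]
      refine sum_congr rfl fun r _ => ?_
      rw [mul_sub, show r * (wt u : ZMod 3) = (wt u : ZMod 3) * r by ring, sub_eq_add_neg, AddChar.map_add_eq_mul,
        char_natMul, mul_comm]
    by_cases hu : wt u % 3 = w
    · rw [if_pos hu] at hind ⊢
      rw [mul_one] at hind
      rw [sign_split_window ℓ y c w hy hℓ hℓn u (by rw [hu, Nat.mod_eq_of_lt hw])]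
      calc (3 : ℂ) * (pathSgn (Etab ℓ y c w) 0 [] 0 u * ftab ℓ y c w (regAt u n []) (0 + wt u) *
              (ZMod.stdAddChar t : ℂ) ^ wt u)
          = (∑ r : ZMod 3, ZMod.stdAddChar (-(r * (w : ZMod 3))) * (ZMod.stdAddChar r : ℂ) ^ wt u) *
              (pathSgn (Etab ℓ y c w) 0 [] 0 u * ftab ℓ y c w (regAt u n []) (0 + wt u) *
                (ZMod.stdAddChar t : ℂ) ^ wt u) := by rw [← hind]
        _ = _ := by
            rw [Finset.sum_mul]
            refine sum_congr rfl fun r _ => ?_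
            unfold mu; rw [mul_pow]; ring
    · rw [if_neg hu, mul_zero]
      rw [if_neg hu, mul_zero] at hind
      have : ∀ r : ZMod 3, ZMod.stdAddChar (-(r * (w : ZMod 3))) *
          ((mu p (t, r)) ^ wt u * pathSgn (Etab ℓ y c w) 0 [] 0 u * ftab ℓ y c w (regAt u n []) (0 + wt u)) =
          (ZMod.stdAddChar (-(r * (w : ZMod 3))) * (ZMod.stdAddChar r : ℂ) ^ wt u) *
            ((ZMod.stdAddChar t : ℂ) ^ wt u * pathSgn (Etab ℓ y c w) 0 [] 0 u *
              ftab ℓ y c w (regAt u n []) (0 + wt u)) := fun r => by unfold mu; rw [mul_pow]; ring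
      rw [sum_congr rfl fun r _ => this r, ← sum_mul, ← hind, zero_mul]
  simp only [key]
  rw [sum_comm]
  refine sum_congr rfl fun r _ => ?_
  rw [← mul_sum]
  rfl

/-- the class sum is `≤ BW`. -/
theorem norm_classSum_le (ℓ : ℕ) (y : Fin (n + 1) → (Fin n → Bool) → Bool) (hy : WindowLocal ℓ y) (hℓ : 1 ≤ ℓ)
    (hℓn : ℓ ≤ n) (c : ℕ) (w : ℕ) (hw : w < 3) {t : ZMod p} (ht : t ≠ 0) :
    ‖∑ u ∈ univ.filter (fun u : Fin n → Bool => wt u % 3 = w),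
        (∏ g : Fin (n + 1), sgn (fires y c g u)) * (ZMod.stdAddChar t : ℂ) ^ wt u‖ ≤ BW p ℓ n := by
  have h3 := three_mul_classSum p ℓ y hy hℓ hℓn c w hw t
  have hx : ∀ r : ZMod 3, (t, r) ∈ twists p := fun r => by
    simp only [twists, mem_product, mem_erase, mem_univ, and_true]; exact ht
  have key : ‖(3 : ℂ) * ∑ u ∈ univ.filter (fun u : Fin n → Bool => wt u % 3 = w),
        (∏ g : Fin (n + 1), sgn (fires y c g u)) * (ZMod.stdAddChar t : ℂ) ^ wt u‖ ≤ 3 * BW p ℓ n := by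
    rw [h3]
    refine le_trans (norm_sum_le _ _) ?_
    calc _ ≤ ∑ r : ZMod 3, BW p ℓ n := sum_le_sum fun r _ => by
            rw [norm_mul, AddChar.norm_apply, one_mul]; exact norm_GG_window_le p (hx r) ℓ y hy (by omega) c w
      _ = 3 * BW p ℓ n := by rw [sum_const, card_univ, ZMod.card]; simp
  rw [norm_mul, (by norm_num : ‖(3 : ℂ)‖ = 3)] at key
  linarith

/-- the full signed sum is `≤ 3 · BW`. -/
theorem norm_signedSum_le (ℓ : ℕ) (y : Fin (n + 1) → (Fin n → Bool) → Bool) (hy : WindowLocal ℓ y) (hℓ : 1 ≤ ℓ)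
    (hℓn : ℓ ≤ n) (c : ℕ) {t : ZMod p} (ht : t ≠ 0) :
    ‖∑ u : Fin n → Bool, (∏ g : Fin (n + 1), sgn (fires y c g u)) * (ZMod.stdAddChar t : ℂ) ^ wt u‖
      ≤ 3 * BW p ℓ n := by
  rw [← sum_fiberwise_of_maps_to (s := univ) (t := range 3) (g := fun u : Fin n → Bool => wt u % 3)
    (fun u _ => mem_range.2 (Nat.mod_lt _ (by norm_num)))]
  refine le_trans (norm_sum_le _ _) ?_
  calc _ ≤ ∑ w ∈ range 3, BW p ℓ n := sum_le_sum fun w hw => norm_classSum_le p ℓ y hy hℓ hℓn c w (mem_range.1 hw) ht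
    _ = 3 * BW p ℓ n := by simp

/-- the twisted win sum `A_t(y) = Σ_u [WIN_y u] ψ(t)^{wt u}`. -/
def twistSum (c : ℕ) (y : Fin (n + 1) → (Fin n → Bool) → Bool) (t : ZMod p) : ℂ :=
  ∑ u : Fin n → Bool, (if ringWinU c y u = true then (1 : ℂ) else 0) * (ZMod.stdAddChar t : ℂ) ^ wt u

/-- **twisted win sums of window strategies are small**: `‖A_t(y)‖ ≤ 2 · 2ⁿ κ^{⌊n/(2ℓ+3)⌋}` for `t ≠ 0`. -/
theorem norm_twistSum_window_le (ℓ : ℕ) (hℓ : 1 ≤ ℓ) (hℓn : ℓ ≤ n) (y : Fin (n + 1) → (Fin n → Bool) → Bool)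
    (hy : WindowLocal ℓ y) (c : ℕ) {t : ZMod p} (ht : t ≠ 0) : ‖twistSum p c y t‖ ≤ 2 * BW p ℓ n := by
  unfold twistSum
  simp only [win_indicator]
  have hx : (t, (0 : ZMod 3)) ∈ twists p := by
    simp only [twists, mem_product, mem_erase, mem_univ, and_true]; exact ht
  have e : ∑ u : Fin n → Bool, (1 - ∏ g : Fin (n + 1), sgn (fires y c g u)) / 2 * (ZMod.stdAddChar t : ℂ) ^ wt u
      = ((∑ u : Fin n → Bool, (ZMod.stdAddChar t : ℂ) ^ wt u) -
          ∑ u : Fin n → Bool, (∏ g : Fin (n + 1), sgn (fires y c g u)) * (ZMod.stdAddChar t : ℂ) ^ wt u) / 2 := by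
    rw [sub_div, Finset.sum_div, Finset.sum_div, ← Finset.sum_sub_distrib]
    refine sum_congr rfl fun u _ => ?_; ring
  rw [e, norm_div, show ‖(2 : ℂ)‖ = 2 by norm_num]
  have h1 : ‖∑ u : Fin n → Bool, (ZMod.stdAddChar t : ℂ) ^ wt u‖ ≤ BW p ℓ n := by
    have := norm_GG_plain_le p hx ℓ n
    rwa [← sum_pow_wt_eq_GG, show mu p (t, 0) = ZMod.stdAddChar t by simp [mu]] at this
  have h2 := norm_signedSum_le p ℓ y hy hℓ hℓn c ht
  calc _ ≤ (BW p ℓ n + 3 * BW p ℓ n) / 2 := by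
        exact div_le_div_of_nonneg_right (le_trans (norm_sub_le _ _) (add_le_add h1 h2)) (by norm_num)
    _ = 2 * BW p ℓ n := by ring

/-- **h2 for the polylog schedule**: at window `(log₂ n)^C` the twisted win sums are `o(2ⁿ)`, uniformly. -/
theorem window_twist_small (hp : 5 ≤ p) (C : ℕ) : ∀ ε : ℝ, 0 < ε → ∃ n₁ : ℕ, ∀ n ≥ n₁,
    ∀ (c : ℕ) (y : Fin (n + 1) → (Fin n → Bool) → Bool), WindowLocal (Nat.log 2 n ^ C) y →
      ∀ t : ZMod p, t ≠ 0 → ‖twistSum p c y t‖ ≤ ε * 2 ^ n := by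
  intro ε hε
  have hκ0 := kappa_nonneg p
  have hκ1 := kappa_lt_one p hp
  obtain ⟨q₀, hq₀⟩ := exists_pow_lt_of_lt_one (show 0 < ε / 2 by positivity) hκ1
  obtain ⟨N₀, hN₀⟩ := DWalk.const_mul_logPow_le' (5 * (q₀ + 1)) C
  refine ⟨max N₀ 2, fun n hn c y hy t ht => ?_⟩
  set ℓ := Nat.log 2 n ^ C with hℓdef
  have hn2 : 2 ≤ n := le_trans (le_max_right _ _) hn
  have hℓ1 : 1 ≤ ℓ := Nat.one_le_pow _ _ (Nat.log_pos one_lt_two hn2)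
  have hmain : 5 * (q₀ + 1) * ℓ ≤ n := hN₀ n (le_trans (le_max_left _ _) hn)
  have hℓn : ℓ ≤ n := by nlinarith
  have hq : q₀ ≤ n / (2 * ℓ + 3) := (Nat.le_div_iff_mul_le (by omega)).2 (by nlinarith)
  have hB := norm_twistSum_window_le p ℓ hℓ1 hℓn y hy c ht
  have e : kappa p ^ (n / (2 * ℓ + 3)) ≤ ε / 2 := le_trans (pow_le_pow_of_le_one hκ0 hκ1.le hq) hq₀.le
  calc ‖twistSum p c y t‖ ≤ 2 * BW p ℓ n := hB
    _ = 2 * 2 ^ n * kappa p ^ (n / (2 * ℓ + 3)) := by unfold BW; ring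
    _ ≤ 2 * 2 ^ n * (ε / 2) := by gcongr
    _ = ε * 2 ^ n := by ring

/-! ### the counter dial -/

/-- the counter dial: a class-indexed family of strategies realised by consulting the class `wt u mod p`. -/
def counterStrat (Y : ZMod p → Fin (n + 1) → (Fin n → Bool) → Bool) : Fin (n + 1) → (Fin n → Bool) → Bool :=
  fun g u => Y ((wt u : ℕ) : ZMod p) g u

/-- class decomposition of the win count of a counter-dial strategy. -/
theorem card_win_counter_eq_sum (c : ℕ) (Y : ZMod p → Fin (n + 1) → (Fin n → Bool) → Bool) :
    #{u : Fin n → Bool | ringWinU c (counterStrat p Y) u = true} =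
      ∑ s : ZMod p, #{u : Fin n → Bool | ringWinU c (Y s) u = true ∧ (wt u : ZMod p) = s} := by
  rw [card_eq_sum_card_fiberwise (f := fun u : Fin n → Bool => ((wt u : ℕ) : ZMod p)) (t := univ) fun u _ => mem_univ _]
  refine sum_congr rfl fun s _ => ?_
  rw [filter_filter]
  congr 1
  refine filter_congr fun u _ => ?_
  refine ⟨fun h => ⟨?_, h.2⟩, fun h => ⟨?_, h.2⟩⟩
  · rw [← h.1]; symm
    exact UnreadTwist.ringWinU_congr fun g => by simp only [counterStrat, h.2]
  · rw [← h.1]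
    exact UnreadTwist.ringWinU_congr fun g => by simp only [counterStrat, h.2]

/-- **the class bound** for an arbitrary strategy: `p · #{wt ≡ s, WIN_y} ≤ #WIN_y + Σ_{t ≠ 0} ‖A_t(y)‖`. -/
theorem class_count_le_twist (c : ℕ) (y : Fin (n + 1) → (Fin n → Bool) → Bool) (s : ZMod p) :
    (p : ℝ) * #{u : Fin n → Bool | ringWinU c y u = true ∧ (wt u : ZMod p) = s} ≤
      #{u : Fin n → Bool | ringWinU c y u = true} + ∑ t ∈ univ.erase (0 : ZMod p), ‖twistSum p c y t‖ := by
  have hid : (p : ℂ) * ((#{u : Fin n → Bool | ringWinU c y u = true ∧ (wt u : ZMod p) = s} : ℕ) : ℂ) =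
      ∑ t : ZMod p, ZMod.stdAddChar (-(t * s)) * twistSum p c y t := by
    have e1 : ((#{u : Fin n → Bool | ringWinU c y u = true ∧ (wt u : ZMod p) = s} : ℕ) : ℂ) =
        ∑ u : Fin n → Bool, (if ringWinU c y u = true then (1 : ℂ) else 0) *
          (if (wt u : ZMod p) - s = 0 then (1 : ℂ) else 0) := by
      rw [← sum_boole]
      refine sum_congr rfl fun u _ => ?_
      by_cases h1 : (wt u : ZMod p) = s <;> by_cases h2 : ringWinU c y u = true <;> simp [h1, h2, sub_eq_zero]
    rw [e1, mul_sum]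
    have e2 : ∀ u : Fin n → Bool, (p : ℂ) * ((if ringWinU c y u = true then (1 : ℂ) else 0) *
        (if (wt u : ZMod p) - s = 0 then (1 : ℂ) else 0)) =
        ∑ t : ZMod p, ZMod.stdAddChar (-(t * s)) *
          ((if ringWinU c y u = true then (1 : ℂ) else 0) * (ZMod.stdAddChar t : ℂ) ^ wt u) := by
      intro u
      have h := ite_eq_sum_char p ((wt u : ZMod p) - s)
      rw [show (if (wt u : ZMod p) - s = 0 then (p : ℂ) else 0) = (p : ℂ) * (if (wt u : ZMod p) - s = 0 then 1 else 0)
        by rw [mul_ite, mul_one, mul_zero]] at h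
      rw [mul_left_comm, h, mul_sum]
      refine sum_congr rfl fun t _ => ?_
      rw [mul_sub, show t * (wt u : ZMod p) = (wt u : ZMod p) * t by ring, sub_eq_add_neg, AddChar.map_add_eq_mul,
        char_natMul]
      ring
    simp only [e2]
    rw [sum_comm]
    refine sum_congr rfl fun t _ => ?_
    rw [twistSum, mul_sum]
  have hA0 : twistSum p c y 0 = (#{u : Fin n → Bool | ringWinU c y u = true} : ℂ) := by
    rw [twistSum]; simp only [AddChar.map_zero_eq_one, one_pow, mul_one]; rw [sum_boole]
  have hnorm : (p : ℝ) * #{u : Fin n → Bool | ringWinU c y u = true ∧ (wt u : ZMod p) = s} ≤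
      ∑ t : ZMod p, ‖twistSum p c y t‖ := by
    have : (p : ℝ) * #{u : Fin n → Bool | ringWinU c y u = true ∧ (wt u : ZMod p) = s} =
        ‖(p : ℂ) * ((#{u : Fin n → Bool | ringWinU c y u = true ∧ (wt u : ZMod p) = s} : ℕ) : ℂ)‖ := by
      rw [norm_mul, Complex.norm_natCast, Complex.norm_natCast]
    rw [this, hid]
    refine le_trans (norm_sum_le _ _) (sum_le_sum fun t _ => ?_)
    rw [norm_mul, AddChar.norm_apply, one_mul]
  rw [← add_sum_erase univ (fun t => ‖twistSum p c y t‖) (mem_univ (0 : ZMod p)), hA0] at hnorm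
  simpa only [Complex.norm_natCast] using hnorm

/-- **COUNTER-DIAL FOURIER REDUCTION** (explicit rate).  A class of strategies that loses with rate `θ₀` (`h1`) and has
`o(2ⁿ)` twisted win sums (`h2`) yields counter-dial strategies losing with rate `(1 + θ₀)/2`. -/
theorem counter_reduction (good : ∀ {n : ℕ}, ℕ → (Fin (n + 1) → (Fin n → Bool) → Bool) → Prop) {θ₀ : ℝ}
    (h1 : ∃ n₀ : ℕ, ∀ n ≥ n₀, ∀ (c : ℕ) (y : Fin (n + 1) → (Fin n → Bool) → Bool),
      good c y → (#{u : Fin n → Bool | ringWinU c y u = true} : ℝ) ≤ θ₀ * 2 ^ n)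
    (h2 : ∀ ε : ℝ, 0 < ε → ∃ n₁ : ℕ, ∀ n ≥ n₁, ∀ (c : ℕ) (y : Fin (n + 1) → (Fin n → Bool) → Bool),
      good c y → ∀ t : ZMod p, t ≠ 0 → ‖twistSum p c y t‖ ≤ ε * 2 ^ n) (hθ₀ : θ₀ < 1) :
    ∃ n₂ : ℕ, ∀ n ≥ n₂, ∀ (c : ℕ) (Y : ZMod p → Fin (n + 1) → (Fin n → Bool) → Bool),
      (∀ s, good c (Y s)) →
        (#{u : Fin n → Bool | ringWinU c (counterStrat p Y) u = true} : ℝ) ≤ (θ₀ + (1 - θ₀) / 2) * 2 ^ n := by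
  obtain ⟨n₀, hn₀⟩ := h1
  have hp0 : (0 : ℝ) < p := by exact_mod_cast (Fact.out : p.Prime).pos
  set ε : ℝ := (1 - θ₀) / 2 with hε
  have hε0 : 0 < ε := by rw [hε]; linarith
  obtain ⟨n₁, hn₁⟩ := h2 (ε / p) (by positivity)
  refine ⟨max n₀ n₁, fun n hn c Y hY => ?_⟩
  have hA : n₀ ≤ n := le_trans (le_max_left _ _) hn
  have hB : n₁ ≤ n := le_trans (le_max_right _ _) hn
  have hcls : ∀ s : ZMod p,
      (p : ℝ) * #{u : Fin n → Bool | ringWinU c (Y s) u = true ∧ (wt u : ZMod p) = s} ≤ θ₀ * 2 ^ n + ε * 2 ^ n := by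
    intro s
    refine le_trans (class_count_le_twist p c (Y s) s) (add_le_add (hn₀ n hA c _ (hY s)) ?_)
    calc ∑ t ∈ univ.erase (0 : ZMod p), ‖twistSum p c (Y s) t‖ ≤ ∑ t ∈ univ.erase (0 : ZMod p), ε / p * 2 ^ n :=
          sum_le_sum fun t ht => hn₁ n hB c _ (hY s) t (ne_of_mem_erase ht)
      _ ≤ p * (ε / p * 2 ^ n) := by
          rw [sum_const, nsmul_eq_mul]
          refine mul_le_mul_of_nonneg_right ?_ (by positivity)
          exact_mod_cast le_trans card_erase_le (by rw [card_univ, ZMod.card])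
      _ = ε * 2 ^ n := by field_simp
  have hsum : (p : ℝ) * #{u : Fin n → Bool | ringWinU c (counterStrat p Y) u = true} ≤ p * (θ₀ * 2 ^ n + ε * 2 ^ n) := by
    rw [card_win_counter_eq_sum p c Y]
    push_cast
    rw [mul_sum]
    calc _ ≤ ∑ s : ZMod p, (θ₀ * 2 ^ n + ε * 2 ^ n) := sum_le_sum fun s _ => hcls s
      _ = p * (θ₀ * 2 ^ n + ε * 2 ^ n) := by rw [sum_const, card_univ, ZMod.card, nsmul_eq_mul]
  have := le_of_mul_le_mul_left hsum hp0
  linarith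

/-- **MAIN THEOREM (the window ⊕ counter rung).**  For every prime `p ≥ 5` there is ONE `θ < 1` such that for every
`C`, eventually in `n`, every strategy each of whose cuts reads a WINDOW of `(log₂ n)^C` bits around itself AND the
global counter `wt u mod p` (through arbitrary tables) wins the walk game on at most `θ · 2ⁿ` inputs. -/
theorem windowCounter_hard (hp : 5 ≤ p) : ∃ θ : ℝ, θ < 1 ∧ ∀ C : ℕ, ∃ n₀ : ℕ, ∀ n ≥ n₀,
    ∀ (c : ℕ) (Y : ZMod p → Fin (n + 1) → (Fin n → Bool) → Bool),
      (∀ s, WindowLocal (Nat.log 2 n ^ C) (Y s)) →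
        (#{u : Fin n → Bool | ringWinU c (counterStrat p Y) u = true} : ℝ) ≤ θ * 2 ^ n := by
  obtain ⟨θ₀, hθ₀, H⟩ := windowLocalHardU
  refine ⟨θ₀ + (1 - θ₀) / 2, by linarith, fun C => ?_⟩
  obtain ⟨n₀, hn₀⟩ := H C
  exact counter_reduction p (fun {n} _ y => WindowLocal (Nat.log 2 n ^ C) y) ⟨n₀, fun n hn c y hy => hn₀ n hn c y hy⟩
    (window_twist_small p hp C) hθ₀

end Main


/-! ## §E corollary: R1a (own bit = window `1`) -/

section Corollaries

variable (p : ℕ) {n : ℕ}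

/-- the own bit of cut `g < n` (cut `n` has none). -/
def ob (g : Fin (n + 1)) (u : Fin n → Bool) : Bool := if h : g.val < n then u ⟨g.val, h⟩ else false

/-- CharDialWindowCounter helper `windowLocal_one_ob` (decomp-qadv land package; see the module docstring). -/
theorem windowLocal_one_ob (T : Fin (n + 1) → Bool → Bool) : WindowLocal 1 (fun g u => T g (ob g u)) := by
  intro g u v huv
  simp only [ob]
  split_ifs with h
  · rw [huv ⟨g.val, h⟩ (Nat.le_succ _) (Nat.lt_succ_self _)]
  · rfl

variable [Fact p.Prime]

/-- **R1a** (the node's `OwnBitCounterHard p`, every prime `p ≥ 5`; part 13's `obc_hard`): own-bit ⊕ counter TABLE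
strategies `y_g(u) = T g u_g (wt u mod p)` lose — the window-`1` (`C = 0`) case of `windowCounter_hard`. -/
theorem ownBitCounter_hard (hp : 5 ≤ p) : ∃ θ : ℝ, θ < 1 ∧ ∃ n₀ : ℕ, ∀ n ≥ n₀, ∀ (c : ℕ)
    (T : Fin (n + 1) → Bool → ZMod p → Bool),
      (#{u : Fin n → Bool | ringWinU c (fun g u => T g (ob g u) ((wt u : ℕ) : ZMod p)) u = true} : ℝ) ≤ θ * 2 ^ n := by
  obtain ⟨θ, hθ, H⟩ := windowCounter_hard p hp
  obtain ⟨n₀, hn₀⟩ := H 0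
  refine ⟨θ, hθ, n₀, fun n hn c T => ?_⟩
  exact hn₀ n hn c (fun s g u => T g (ob g u) s) fun s => by rw [pow_zero]; exact windowLocal_one_ob fun g b => T g b s

end Corollaries

end Summit.QuantumAdvantage.AdviceFreeQNC0.WindowCounter
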